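import Mathlib.Analysis.CStarAlgebra.Matrix
import Literature.Analysis.FunctionSpaces.TorusIntegerEndomorphism
import Literature.Analysis.FunctionSpaces.TorusCalculusProofs
import HarnessLib

/-!
# Calculus of pull-backs along integer-matrix endomorphisms of the flat torus

Analysis/FunctionSpaces support file (all results proved; no definitions, no named facts),
continuing `TorusIntegerEndomorphism` (the endomorphism `x ↦ M • x` of `T^d = (ℝ/ℤ)^d` induced by
an integer matrix `M ∈ M_d(ℤ)`: `Torus.mulVecT`, continuity, `M • proj y = proj (My)`, Haar
invariance for `det M ≠ 0`) with the DIFFERENTIAL calculus of the pull-backs `f ∘ (M • ·)` in the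
torus vocabulary of `TorusCalculus` (`Torus.lift`, `Torus.IsContDiff/IsSmooth`, `Torus.lineDeriv`,
`Torus.partialDeriv`, `Torus.fderiv`):

* `Torus.mulVecT_proj_eq_toEuclideanCLM` — `M • proj y = proj (M_ℝ y)` with the real matrix of `M`
  acting as the continuous linear map `Matrix.toEuclideanCLM (M.map Int.cast)` of `ℝ^d`, whence
  `lift (f ∘ (M • ·)) = lift f ∘ M_ℝ` (`Torus.lift_comp_mulVecT`);
* smoothness: `Torus.IsContDiff.comp_mulVecT`, `Torus.IsSmooth.comp_mulVecT`;
* the **chain rule**: `D(f ∘ M•)(x) = Df(M • x) ∘ M_ℝ` (`Torus.fderiv_comp_mulVecT`),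
  `∂ᵥ(f ∘ M•)(x) = ∂_{M_ℝ v} f (M • x)` (`Torus.lineDeriv_comp_mulVecT`), and in coordinates, for an
  integer direction `θ ∈ ℤ^d`,
  `∑ᵢ θᵢ ∂ᵢ (f ∘ M•)(x) = ∑ᵢ (Mθ)ᵢ ∂ᵢ f (M • x)` (`Torus.sum_smul_partialDeriv_comp_mulVecT`):
  directional derivatives along `θ` of the pull-back are directional derivatives along `Mθ` of
  `f`. In particular a pull-back `f ∘ M•` is constant along `θ` as soon as `f` is constant along
  `Mθ` (`Torus.sum_smul_partialDeriv_comp_mulVecT_eq_zero`).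

Use (first consumer): the pipe profiles of the Mikado potentials of Coiculescu–Palasek
(Invent. Math. 244 (2025), Def. 3.1; `FluidPDE/MikadoShearPotential`) around a periodic line of
integer direction `θ = (θ₁, θ₂, 1)` are pull-backs `ρ ∘ π₁₂ ∘ Φ•` of planar profiles along the
unimodular matrix `Φ = [[1,0,-θ₁],[0,1,-θ₂],[0,0,1]]` (`Φθ = e₃`), and their constancy along `θ` is
the case `f = ρ ∘ π₁₂`, `Mθ = e₃` of the last statement.

## Mathlib / tree search

Reused: `Torus.mulVecT`, `Torus.mulVecT_proj` (`TorusIntegerEndomorphism`); `Torus.fderiv_lift`,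
`Torus.lineDeriv_eq_fderiv_apply`, `Torus.fderiv_apply_eq_sum_partialDeriv`,
`Torus.proj_surjective` (`TorusCalculus(Proofs)`, `FlatTorus`); Mathlib's `Matrix.toEuclideanCLM`
(`Mathlib.Analysis.CStarAlgebra.Matrix`) and `fderiv_comp`. No prior differential calculus for
`mulVecT` (`lean search 'comp_mulVecT|mulVecT.*lineDeriv|mulVecT.*IsSmooth'`: only the measure
statements `eLpNorm/integral_comp_mulVecT_add`).

## References

* L. Grafakos, *Classical Fourier Analysis*, 3rd ed., GTM 249 (2014), §3.1.1 (functions on the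
  torus as periodic functions on `ℝⁿ`; automorphisms). [`Grafakos2014`]
* M. P. Coiculescu, S. Palasek, Invent. Math. 244 (2025) 165–219, arXiv:2503.14699, §3.1
  (pipes along integer directions). [`CoiculescuPalasek2025`]
-/

noncomputable section

open Set Function UnitAddTorus

namespace Literature.Analysis.FunctionSpaces

namespace Torus

variable {d : Type*} [Fintype d] [DecidableEq d]
variable {F : Type*} [NormedAddCommGroup F] [NormedSpace ℝ F]

/-! ## The real matrix of `M` as a continuous linear map, and the lift of a pull-back -/

omit [DecidableEq d] in
/-- **`M • proj y = proj (M_ℝ y)`** with `M_ℝ = Matrix.toEuclideanCLM (M.map Int.cast)` the real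
matrix of `M` acting on `ℝ^d` (a restatement of `Torus.mulVecT_proj`). [folklore] -/
theorem mulVecT_proj_eq_toEuclideanCLM [DecidableEq d] (M : Matrix d d ℤ) (y : EuclideanSpace ℝ d) :
    mulVecT M (proj y) =
      proj (Matrix.toEuclideanCLM (n := d) (𝕜 := ℝ) (M.map (Int.cast : ℤ → ℝ)) y) := by
  rw [mulVecT_proj]
  rfl

omit [NormedAddCommGroup F] [NormedSpace ℝ F] in
/-- **The lift of a pull-back**: `lift (f ∘ (M • ·)) = lift f ∘ M_ℝ`. [folklore] -/
theorem lift_comp_mulVecT (f : UnitAddTorus d → F) (M : Matrix d d ℤ) :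
    lift (f ∘ mulVecT M) =
      lift f ∘ Matrix.toEuclideanCLM (n := d) (𝕜 := ℝ) (M.map (Int.cast : ℤ → ℝ)) := by
  funext y
  simp only [comp_apply, lift_apply, mulVecT_proj_eq_toEuclideanCLM]

/-! ## Smoothness -/

/-- Pull-backs of `C^n` functions along `x ↦ M • x` are `C^n`. [folklore] -/
theorem IsContDiff.comp_mulVecT {n : WithTop ℕ∞} {f : UnitAddTorus d → F} (hf : IsContDiff n f)
    (M : Matrix d d ℤ) : IsContDiff n (f ∘ mulVecT M) := by
  unfold IsContDiff at hf ⊢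
  rw [lift_comp_mulVecT]
  exact hf.comp (Matrix.toEuclideanCLM (n := d) (𝕜 := ℝ) (M.map (Int.cast : ℤ → ℝ))).contDiff

/-- Pull-backs of smooth functions along `x ↦ M • x` are smooth. [folklore] -/
theorem IsSmooth.comp_mulVecT {f : UnitAddTorus d → F} (hf : IsSmooth f) (M : Matrix d d ℤ) :
    IsSmooth (f ∘ mulVecT M) :=
  IsContDiff.comp_mulVecT hf M

/-- The same for `fun x => f (M • x)`. [folklore] -/
theorem IsSmooth.comp_mulVecT' {f : UnitAddTorus d → F} (hf : IsSmooth f) (M : Matrix d d ℤ) :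
    IsSmooth (fun x => f (mulVecT M x)) :=
  IsContDiff.comp_mulVecT hf M

/-! ## The chain rule -/

/-- **Chain rule for the torus derivative**: `D(f ∘ M•)(x) = Df(M • x) ∘ M_ℝ` for `C¹` `f`.
[folklore] -/
theorem fderiv_comp_mulVecT {f : UnitAddTorus d → F} (hf : IsContDiff 1 f) (M : Matrix d d ℤ)
    (x : UnitAddTorus d) :
    Torus.fderiv (f ∘ mulVecT M) x =
      (Torus.fderiv f (mulVecT M x)).comp
        (Matrix.toEuclideanCLM (n := d) (𝕜 := ℝ) (M.map (Int.cast : ℤ → ℝ))) := by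
  obtain ⟨y, rfl⟩ := proj_surjective x
  set L := Matrix.toEuclideanCLM (n := d) (𝕜 := ℝ) (M.map (Int.cast : ℤ → ℝ)) with hL
  have hdf : DifferentiableAt ℝ (lift f) (L y) :=
    ((show ContDiff ℝ 1 (lift f) from hf).differentiable one_ne_zero).differentiableAt
  rw [← fderiv_lift, lift_comp_mulVecT, ← hL, _root_.fderiv_comp y hdf L.differentiableAt,
    L.fderiv, fderiv_lift, mulVecT_proj_eq_toEuclideanCLM]

/-- **Chain rule for directional derivatives**: `∂ᵥ(f ∘ M•)(x) = ∂_{M_ℝ v} f (M • x)` for `C¹` `f`.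
[folklore] -/
theorem lineDeriv_comp_mulVecT {f : UnitAddTorus d → F} (hf : IsContDiff 1 f) (M : Matrix d d ℤ)
    (x : UnitAddTorus d) (v : EuclideanSpace ℝ d) :
    lineDeriv (f ∘ mulVecT M) x v =
      lineDeriv f (mulVecT M x) (Matrix.toEuclideanCLM (n := d) (𝕜 := ℝ) (M.map (Int.cast : ℤ → ℝ)) v) := by
  rw [lineDeriv_eq_fderiv_apply (hf.comp_mulVecT M), lineDeriv_eq_fderiv_apply hf,
    fderiv_comp_mulVecT hf M x, ContinuousLinearMap.comp_apply]

omit [DecidableEq d] in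
/-- Coordinates of the real matrix applied to an integer vector: `(M_ℝ θ)ᵢ = (Mθ)ᵢ`. [folklore] -/
theorem toEuclideanCLM_map_intCast_apply [DecidableEq d] (M : Matrix d d ℤ) (θ : d → ℤ) (i : d) :
    Matrix.toEuclideanCLM (n := d) (𝕜 := ℝ) (M.map (Int.cast : ℤ → ℝ))
        (WithLp.toLp 2 fun j => (θ j : ℝ)) i = ((M.mulVec θ) i : ℝ) := by
  rw [Matrix.toEuclideanCLM_toLp, PiLp.toLp_apply]
  simp only [Matrix.mulVec, dotProduct, Matrix.map_apply]
  push_cast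
  rfl

/-- **Directional derivatives along integer directions, in coordinates**: for `θ ∈ ℤ^d` and
`C¹` `f`, `∑ᵢ θᵢ • ∂ᵢ (f ∘ M•)(x) = ∑ᵢ (Mθ)ᵢ • ∂ᵢ f (M • x)` — the derivative of the pull-back along
`θ` is the derivative of `f` along `Mθ`. [folklore] -/
theorem sum_smul_partialDeriv_comp_mulVecT {f : UnitAddTorus d → F} (hf : IsContDiff 1 f)
    (M : Matrix d d ℤ) (θ : d → ℤ) (x : UnitAddTorus d) :
    ∑ i, (θ i : ℝ) • partialDeriv i (f ∘ mulVecT M) x =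
      ∑ i, ((M.mulVec θ) i : ℝ) • partialDeriv i f (mulVecT M x) := by
  set v : EuclideanSpace ℝ d := WithLp.toLp 2 fun j => (θ j : ℝ) with hv
  have h1 : ∑ i, (θ i : ℝ) • partialDeriv i (f ∘ mulVecT M) x =
      Torus.fderiv (f ∘ mulVecT M) x v := by
    rw [fderiv_apply_eq_sum_partialDeriv (hf.comp_mulVecT M)]
  have h2 : ∑ i, ((M.mulVec θ) i : ℝ) • partialDeriv i f (mulVecT M x) =
      Torus.fderiv f (mulVecT M x)
        (Matrix.toEuclideanCLM (n := d) (𝕜 := ℝ) (M.map (Int.cast : ℤ → ℝ)) v) := by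
    rw [fderiv_apply_eq_sum_partialDeriv hf]
    refine Finset.sum_congr rfl fun i _ => ?_
    rw [hv, toEuclideanCLM_map_intCast_apply]
  rw [h1, h2, fderiv_comp_mulVecT hf M x, ContinuousLinearMap.comp_apply]

/-- **Constancy along a direction is transported by pull-back**: if `f` is constant along `Mθ`
(`∑ᵢ (Mθ)ᵢ • ∂ᵢ f ≡ 0`) then `f ∘ M•` is constant along `θ`. [folklore] -/
theorem sum_smul_partialDeriv_comp_mulVecT_eq_zero {f : UnitAddTorus d → F} (hf : IsContDiff 1 f)
    (M : Matrix d d ℤ) (θ : d → ℤ)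
    (hθ : ∀ z, ∑ i, ((M.mulVec θ) i : ℝ) • partialDeriv i f z = 0) (x : UnitAddTorus d) :
    ∑ i, (θ i : ℝ) • partialDeriv i (f ∘ mulVecT M) x = 0 := by
  rw [sum_smul_partialDeriv_comp_mulVecT hf M θ x]
  exact hθ _

/-- Real-valued form of `sum_smul_partialDeriv_comp_mulVecT` (products instead of scalar
multiples). [folklore] -/
theorem sum_mul_partialDeriv_comp_mulVecT {f : UnitAddTorus d → ℝ} (hf : IsContDiff 1 f)
    (M : Matrix d d ℤ) (θ : d → ℤ) (x : UnitAddTorus d) :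
    ∑ i, (θ i : ℝ) * partialDeriv i (f ∘ mulVecT M) x =
      ∑ i, ((M.mulVec θ) i : ℝ) * partialDeriv i f (mulVecT M x) := by
  have h := sum_smul_partialDeriv_comp_mulVecT hf M θ x
  simpa only [smul_eq_mul] using h

end Torus

end Literature.Analysis.FunctionSpaces
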